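import Literature.AlgebraicTopology.SingularHomology.HurewiczSimplexClass
import Literature.AlgebraicTopology.SingularHomology.RelativeHurewicz
import Literature.AlgebraicTopology.Homotopy.HomotopyGroupsGeneralPosition
import Literature.AlgebraicTopology.Homotopy.RelativeHomotopySequence
import Literature.AlgebraicTopology.Homotopy.RelativeLiddedCubes
import Literature.AlgebraicTopology.FundamentalGroup.SphereSimplyConnected
import HarnessLib

/-!
# The pair `(Δᴺ, ∂Δᴺ)` is `(N-1)`-connected

Topic `Literature/AlgebraicTopology/SingularHomology`. Elementary connectivity facts about the
standard simplex `Δᴺ = StdSimplex N` and its boundary `∂Δᴺ = stdBoundary N`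
(`StdSimplexFaces.lean`, `HurewiczSimplexClass.lean`), needed to run the tree's Hurewicz machinery
(relative Eilenberg retractions `exists_relEilenbergRetraction₁`, Spanier's Cor. 7.4.9
`isIso_toRelativeHomology_holds`) in the *universal example* `(Δᴺ, ∂Δᴺ, v₀)` of the relative
homotopy addition theorem (E. H. Spanier, *Algebraic Topology* (1981), Ch. 7 §5 Prop. 3, whose
element `bₙ` lives in `πₙ(Δ̇ⁿ⁺¹, (Δⁿ⁺¹)ⁿ⁻¹, v₀)`). Everything is PROVED:

* `stdBoundaryHomeoSphere N : ↥(stdBoundary N) ≃ₜ sphere 0 1` — the boundary of `Δᴺ` is the unit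
  sphere of `ℝᴺ` in the sup norm (restriction of the radial homeomorphism `SimplexBall.toBall`,
  `Homotopy/SimplexBallHomeomorph.lean`; Hatcher, *Algebraic Topology* (2002), §2.1: `Δⁿ` is a disc);
* `subsingleton_homotopyGroup_stdBoundary` — `π_j(∂Δᴺ) = 0` for `j + 1 < N` (general position,
  `subsingleton_homotopyGroup_sphere`, Hatcher Cor. 4.9), whence `pathConnectedSpace_stdBoundary`
  (`N ≥ 2`) and `simplyConnectedSpace_stdBoundary` (`N ≥ 3`);
* `contractibleSpace_stdSimplex`, `simplyConnectedSpace_stdSimplex`, `subsingleton_homotopyGroup_stdSimplex`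
  — the simplex is convex;
* `subsingleton_relHomotopyGroup_stdSimplex_stdBoundary` — **`π_q(Δᴺ, ∂Δᴺ, b) = 0` for
  `1 ≤ q ≤ N - 1`** and every base point `b` (exactness of the homotopy sequence of the pair,
  `RelativeHomotopySequence.lean`, Hatcher Thm. 4.3).

Stated as theorems, not instances (no global instances on Mathlib's `stdSimplex`).

## References

* A. Hatcher, *Algebraic Topology*, CUP (2002), §2.1; Thm. 4.3; Cor. 4.9. [HatcherAT2002]
* E. H. Spanier, *Algebraic Topology*, Springer (1981), Ch. 7 §5, Prop. 3. [Spanier1981]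
-/

noncomputable section

open Set Metric
open scoped Topology

namespace Literature.AlgebraicTopology.SingularHomology

open Literature.AlgebraicTopology.Homotopy

/-! ### The boundary of the simplex is a sphere -/

/-- The points of the closed unit ball lying on the unit sphere form a copy of the sphere.
[folklore] -/
def ballSphereHomeoSphere (N : ℕ) :
    {y : closedBall (0 : Fin N → ℝ) 1 // (y : Fin N → ℝ) ∈ sphere (0 : Fin N → ℝ) 1} ≃ₜ
      sphere (0 : Fin N → ℝ) 1 where
  toFun y := ⟨y.1, y.2⟩
  invFun v := ⟨⟨v, sphere_subset_closedBall v.2⟩, v.2⟩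
  left_inv _ := rfl
  right_inv _ := rfl
  continuous_toFun := (continuous_subtype_val.comp continuous_subtype_val).subtype_mk _
  continuous_invFun := (continuous_subtype_val.subtype_mk _).subtype_mk _

/-- **`∂Δᴺ` is homeomorphic to the unit sphere of `ℝᴺ` (sup norm)**: the radial homeomorphism
`SimplexBall.toBall : Δᴺ ≅ D̄ᴺ` carries the points with a vanishing barycentric coordinate onto the
sphere (`SimplexBall.toBall_mem_sphere_iff`). (Hatcher 2002, §2.1: the pair `(Δⁿ, ∂Δⁿ)` is a disc
with its boundary sphere.) [cite: HatcherAT2002, §2.1] -/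
def stdBoundaryHomeoSphere (N : ℕ) : ↥(stdBoundary N) ≃ₜ sphere (0 : Fin N → ℝ) 1 :=
  ((SimplexBall.toBall N).subtype (p := fun t : StdSimplex N => t ∈ stdBoundary N)
      (q := fun y : closedBall (0 : Fin N → ℝ) 1 => (y : Fin N → ℝ) ∈ sphere (0 : Fin N → ℝ) 1)
      (fun t => (SimplexBall.toBall_mem_sphere_iff N t).symm)).trans
    (ballSphereHomeoSphere N)

/-! ### Homotopy groups of the boundary -/

/-- **`π_j(∂Δᴺ) = 0` for `j + 1 < N`** (`π_j(Sᴺ⁻¹) = 0` below the dimension, Hatcher 2002,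
Cor. 4.9, by general position: `subsingleton_homotopyGroup_sphere`), at every base point.
[cite: HatcherAT2002, Cor. 4.9] -/
theorem subsingleton_homotopyGroup_stdBoundary {N j : ℕ} (h : j + 1 < N) (x : ↥(stdBoundary N)) :
    Subsingleton (HomotopyGroup (Fin j) (↥(stdBoundary N)) x) := by
  refine subsingleton_homotopyGroup_of_homotopyEquiv (stdBoundaryHomeoSphere N).toHomotopyEquiv
    (fun y => ?_) x
  exact subsingleton_homotopyGroup_sphere (E := Fin N → ℝ) (by rwa [Module.finrank_fin_fun]) y

/-- The vertex `v₀` of `Δᴺ⁺¹` lies on the boundary (its coordinate `1` vanishes). [folklore] -/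
lemma vertex_zero_mem_stdBoundary (N : ℕ) :
    (stdSimplex.vertex (S := ℝ) (0 : Fin (N + 2)) : StdSimplex (N + 1)) ∈ stdBoundary (N + 1) :=
  ⟨1, by simp [stdSimplex.vertex]⟩

/-- **`∂Δᴺ` is path connected for `N ≥ 2`** (`π₀(Sᴺ⁻¹)` is a point). [cite: HatcherAT2002, Cor. 4.9] -/
theorem pathConnectedSpace_stdBoundary {N : ℕ} (hN : 2 ≤ N) : PathConnectedSpace ↥(stdBoundary N) := by
  obtain ⟨M, rfl⟩ : ∃ M, N = M + 2 := ⟨N - 2, by omega⟩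
  let x : ↥(stdBoundary (M + 2)) := ⟨_, vertex_zero_mem_stdBoundary (M + 1)⟩
  haveI : Subsingleton (HomotopyGroup (Fin 0) (↥(stdBoundary (M + 2))) x) :=
    subsingleton_homotopyGroup_stdBoundary (by omega) x
  rw [pathConnectedSpace_iff_zerothHomotopy]
  exact ⟨⟨homotopyGroupEquivZerothHomotopyOfIsEmpty (Fin 0) x ⟦GenLoop.const⟧⟩,
    (homotopyGroupEquivZerothHomotopyOfIsEmpty (Fin 0) x).symm.subsingleton⟩

/-- **`∂Δᴺ` is simply connected for `N ≥ 3`** (`π₁(Sᴺ⁻¹) = 0`, Hatcher 2002, Prop. 1.14 /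
Cor. 4.9): every loop is null-homotopic since `π₁ ≃ FundamentalGroup` is trivial, and one base
point suffices (`simplyConnectedSpace_of_loops_nullhomotopic_at`). [cite: HatcherAT2002, Cor. 4.9] -/
theorem simplyConnectedSpace_stdBoundary {N : ℕ} (hN : 3 ≤ N) : SimplyConnectedSpace ↥(stdBoundary N) := by
  haveI := pathConnectedSpace_stdBoundary (N := N) (by omega)
  obtain ⟨M, rfl⟩ : ∃ M, N = M + 3 := ⟨N - 3, by omega⟩
  let x : ↥(stdBoundary (M + 3)) := ⟨_, vertex_zero_mem_stdBoundary (M + 2)⟩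
  haveI : Subsingleton (HomotopyGroup (Fin 1) (↥(stdBoundary (M + 3))) x) :=
    subsingleton_homotopyGroup_stdBoundary (by omega) x
  haveI : Subsingleton (FundamentalGroup (↥(stdBoundary (M + 3))) x) :=
    (HomotopyGroup.pi1EquivFundamentalGroup (X := ↥(stdBoundary (M + 3))) (x := x)).symm.subsingleton
  refine FundamentalGroup.simplyConnectedSpace_of_loops_nullhomotopic_at x fun γ => ?_
  have h : (FundamentalGroup.fromPath ⟦γ⟧ : FundamentalGroup _ x) = FundamentalGroup.fromPath ⟦Path.refl x⟧ :=
    Subsingleton.elim _ _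
  exact Quotient.exact h

/-! ### The simplex itself -/

/-- **`Δᴺ` is contractible** (it is convex and nonempty). [folklore] -/
theorem contractibleSpace_stdSimplex (N : ℕ) : ContractibleSpace (StdSimplex N) :=
  (convex_stdSimplex ℝ (Fin (N + 1))).contractibleSpace ⟨_, single_mem_stdSimplex ℝ 0⟩

/-- `Δᴺ` is simply connected. [folklore] -/
theorem simplyConnectedSpace_stdSimplex (N : ℕ) : SimplyConnectedSpace (StdSimplex N) := by
  haveI := contractibleSpace_stdSimplex N
  infer_instance

/-- **All homotopy groups of `Δᴺ` vanish** (it is contractible; the homotopy groups of the one-point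
space are trivial, cf. `Literature.Geometry.Symplectic.subsingleton_homotopyGroup_unit`, not imported
here). [folklore] -/
theorem subsingleton_homotopyGroup_stdSimplex (M : Type*) [Fintype M] {N : ℕ} (x : StdSimplex N) :
    Subsingleton (HomotopyGroup M (StdSimplex N) x) := by
  haveI := contractibleSpace_stdSimplex N
  obtain ⟨e⟩ := ContractibleSpace.hequiv_unit (StdSimplex N)
  have hU : ∀ u : Unit, Subsingleton (HomotopyGroup M Unit u) := fun u =>
    ⟨fun a b => by
      induction a using Quotient.inductionOn
      induction b using Quotient.inductionOn
      exact congrArg _ (Subtype.ext (ContinuousMap.ext fun _ => rfl))⟩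
  exact subsingleton_homotopyGroup_of_homotopyEquiv e hU x

/-! ### The pair `(Δᴺ, ∂Δᴺ)` -/

/-- **`π_{m+2}(Δᴺ, ∂Δᴺ, b) = 0` for `m + 3 ≤ N`**: the boundary `∂c ∈ π_{m+1}(∂Δᴺ)` of a class
`c` is trivial (`m + 2 < N`), so `c = j_* b'` (exactness at `πₙ(X, A, a)`,
`RelHomotopyGroup.exists_ofAbsolute_eq`) with `b' ∈ π_{m+2}(Δᴺ) = 0`. [cite: HatcherAT2002, Thm. 4.3] -/
theorem subsingleton_relHomotopyGroup_stdSimplex_stdBoundary_add_two {N m : ℕ} (h : m + 3 ≤ N)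
    (b : ↥(stdBoundary N)) :
    Subsingleton (RelHomotopyGroup.Pi (m + 2) (StdSimplex N) (stdBoundary N) b) := by
  haveI : Subsingleton (HomotopyGroup (Fin (m + 1)) (↥(stdBoundary N)) b) :=
    subsingleton_homotopyGroup_stdBoundary (by omega) b
  haveI : Subsingleton (HomotopyGroup { j : Fin (m + 2) // j ≠ 0 } (↥(stdBoundary N)) b) :=
    (LiddedCube.reindex (m := m) (Y := ↥(stdBoundary N)) (y₀ := b)).symm.toEquiv.subsingleton
  haveI : Subsingleton (HomotopyGroup (Fin (m + 2)) (StdSimplex N) (b : StdSimplex N)) :=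
    subsingleton_homotopyGroup_stdSimplex _ _
  have key : ∀ c : RelHomotopyGroup.Pi (m + 2) (StdSimplex N) (stdBoundary N) b, c = default := fun c => by
    obtain ⟨b', rfl⟩ := RelHomotopyGroup.exists_ofAbsolute_eq c (Subsingleton.elim _ _)
    rw [Subsingleton.elim b' ⟦GenLoop.const⟧, RelHomotopyGroup.ofAbsolute_const]
  exact ⟨fun c d => (key c).trans (key d).symm⟩

/-- **The pair `(Δᴺ, ∂Δᴺ)` is `(N-1)`-connected: `π_q(Δᴺ, ∂Δᴺ, b) = 0` for `1 ≤ q ≤ N - 1`**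
and every base point `b ∈ ∂Δᴺ` (Hatcher 2002, Thm. 4.3, exactness, with `π_q(Δᴺ) = 0` and
`π_{q-1}(∂Δᴺ) = 0`; the hypothesis `(q+1 ≤ N)` of the tree's `exists_relEilenbergRetraction₁` and
`isIso_toRelativeHomology` in the universal example). [cite: HatcherAT2002, Thm. 4.3] -/
theorem subsingleton_relHomotopyGroup_stdSimplex_stdBoundary {N q : ℕ} [NeZero q] (hq : q + 1 ≤ N)
    (b : ↥(stdBoundary N)) :
    Subsingleton (RelHomotopyGroup.Pi q (StdSimplex N) (stdBoundary N) b) := by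
  rcases Nat.lt_or_ge q 2 with h2 | h2
  · obtain rfl : q = 1 := by have := NeZero.one_le (n := q); omega
    haveI := simplyConnectedSpace_stdSimplex N
    haveI := pathConnectedSpace_stdBoundary (N := N) (by omega)
    exact subsingleton_relHomotopyGroup_one_of_simplyConnectedSpace (stdBoundary N) b
  · obtain ⟨m, rfl⟩ : ∃ m, q = m + 2 := ⟨q - 2, by omega⟩
    exact subsingleton_relHomotopyGroup_stdSimplex_stdBoundary_add_two (by omega) b

end Literature.AlgebraicTopology.SingularHomology

end
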